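import Mathlib
import Literature.NumberTheory.LFunctions.Zhang2022.Section11AFEBlocks
import Literature.NumberTheory.LFunctions.Zhang2022.Section11AFEDualTail
import Literature.NumberTheory.LFunctions.Zhang2022.Section11AFELineSplit
import Literature.NumberTheory.LFunctions.Zhang2022.Section11AFEShiftPole
import HarnessLib

/-!
# Zhang (2022) §11, proof of Lemma 11.2 for `χψ` — the assembly: `Z22:§11.u024` (repaired) from
# its sub-steps; only (6.2) and (6.5) for `χψ` remain as named hypotheses

Topic `Literature/NumberTheory/LFunctions/Zhang2022` (Landau–Siegel audit tree; verdict-neutral).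
Y. Zhang, *Discrete mean estimates and the Landau–Siegel zero*, arXiv:2211.02515v1 (2022)
[Zhang2022LandauSiegel] — **an unrefereed manuscript under adjudication** (campaign D-0069; nothing
here bears on Theorems 1–2 or on Landau–Siegel zeros). Companion of `Section11AFEObjects` (where the
node `Step11u024e` and the sub-steps are typed) and of the kernel files `Section11AFEBlocks`,
`Section11AFEDualTail`, `Section11AFELineSplit`, `Section11AFEShiftPole`.

* `step11u024e_of` — the repaired display `Step11u024e` (`Σ_nχψ(n)n^{−s}g(P^z/n) = L(s,χψ) −
  Z(s,χψ)Σ_nχψ̄(n)n^{−(1−s)}g(P^{1−z}Dt₀/n) + O(E₂(s,ψ) + e^{−c𝓛¹⁰})`) from the five sub-steps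
  (b) `ShiftPole11`, (c) `LineSplit11`, (d) `TailSmall11`, (f) `WindowMove11`, (g) `DualTail11`
  and the kernel blocks (a), (e), (B2): exact bookkeeping, kernel-checked;
* `step11u024e_of_tail_window` — **the same with (b), (c), (g) DISCHARGED** (`shiftPole11_holds`,
  `lineSplit11_holds`, `dualTail11_holds`): the smoothed approximate functional equation for
  `L(s,χψ)` holds GIVEN ONLY the two contour estimates `TailSmall11` (= (6.2) for `χψ`: the
  reflected tail `n ≥ P₁` is `≪ ε`, contour at `u = −𝓛⁹`) and `WindowMove11` (= (6.5) for `χψ`: the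
  segment `u = −1` moved to `u = 0` up to `≪ ε`), which stay CLAIMS of the manuscript's "in a way
  similar to the proof of Lemma 6.1".

## References

* Y. Zhang, arXiv:2211.02515v1 (2022), §11 Lemma 11.2 (proof), p. 65; §6 proof of Lemma 6.1,
  pp. 31–32. [cite: Zhang2022LandauSiegel, §11 Lemma 11.2; §6 Lemma 6.1 (proof)]
-/

noncomputable section

open Complex Real ComplexConjugate MeasureTheory Set Filter Topology

namespace Literature.NumberTheory.LFunctions.Zhang2022.Section11AFE

open Skeleton GaussWeight Section6Statements

/-! ## §1. Assembly -/

section Assembly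

/-- Uniformising the `exp{−c𝓛¹⁰}` of several error terms. [folklore] -/
private theorem exp_mono_c {c c' L : ℝ} (h : c ≤ c') (hL : 0 ≤ L) :
    Real.exp (-c' * L) ≤ Real.exp (-c * L) :=
  Real.exp_le_exp.mpr (by nlinarith)

/-- **`Z22:§11.u024` (repaired) from its sub-steps**, kernel-checked: the smoothed approximate
functional equation `Step11u024e` follows from the contour claims (b) `ShiftPole11`,
(c) `LineSplit11`, (d) `TailSmall11`, (f) `WindowMove11`, (g) `DualTail11` together with the blocks
PROVED in this file — (a) `vline_one_eq_smoothedSum` (the line `u = 1` is the smoothed sum),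
(e) `vline_integrandMain` (the main term `−Z(s,χψ)·Σ_{n<P₁}χψ̄(n)n^{−(1−s)}g(P^{1−z}Dt₀/n)`,
exact) and (B2) `norm_vseg_integrandDiff_le` (the `u = 0` window is `O(E₂(s,ψ))` by Lemma 5.1 (5.4),
the tree's `lemma51_holds`): with `X = P^z`, `R = DPt₀`,
`Σ_nχψ(n)n^{−s}g(X/n) = L(s,χψ) + ∫_{(−1)} = L − Z(s)·dualHead + [window] + O(ε) = L − Z(s)·dualSum
+ O(E₂ + ε)`. [cite: Zhang2022LandauSiegel, §11 Lemma 11.2 (proof), p. 65; §6 proof of Lemma 6.1, pp. 31–32] -/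
theorem step11u024e_of (hb : ShiftPole11) (hc : LineSplit11) (hd : TailSmall11) (hf : WindowMove11)
    (hg : DualTail11) : Step11u024e := by
  obtain ⟨cd, hcd, Cd, Dd, hd⟩ := hd
  obtain ⟨cf, hcf, Cf, Df, hf⟩ := hf
  obtain ⟨cg, hcg, Cg, Dg, hg⟩ := hg
  obtain ⟨Cw, Dw, hw⟩ := norm_vseg_integrandDiff_le
  obtain ⟨Db, hb⟩ := hb
  obtain ⟨Dc, hc⟩ := hc
  set c : ℝ := min cd (min cf cg) with hcdef
  have hc0 : 0 < c := lt_min hcd (lt_min hcf hcg)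
  refine ⟨c, hc0, |Cd| + |Cf| + |Cg| + |Cw|,
    max (max (max Dd Df) (max Dg Dw)) (max (max Db Dc) 3), fun D _ χ hD hq hp _hA x s hre him z hz1 hz2 => ?_⟩
  -- thresholds
  have hDd : Dd ≤ D := le_trans (le_trans (le_max_left _ _) (le_max_left _ _)) (le_trans (le_max_left _ _) hD)
  have hDf : Df ≤ D := le_trans (le_trans (le_max_right _ _) (le_max_left _ _)) (le_trans (le_max_left _ _) hD)
  have hDg : Dg ≤ D := le_trans (le_trans (le_max_left _ _) (le_max_right _ _)) (le_trans (le_max_left _ _) hD)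
  have hDw : Dw ≤ D := le_trans (le_trans (le_max_right _ _) (le_max_right _ _)) (le_trans (le_max_left _ _) hD)
  have hDb : Db ≤ D := le_trans (le_trans (le_max_left _ _) (le_max_left _ _)) (le_trans (le_max_right _ _) hD)
  have hDc : Dc ≤ D := le_trans (le_trans (le_max_right _ _) (le_max_left _ _)) (le_trans (le_max_right _ _) hD)
  have hD3 : 3 ≤ D := le_trans (le_max_right _ _) (le_trans (le_max_right _ _) hD)
  have hD2 : 2 ≤ D := le_trans (by norm_num) hD3
  have hrange : InRange112 D s := ⟨hre, him⟩
  -- positivity of the parameters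
  have hP : 0 < bigP D := Real.exp_pos _
  have hX : 0 < bigP D ^ z := Real.rpow_pos_of_pos hP z
  have hℓ : 0 < ell D := by
    have : (1 : ℝ) < D := by exact_mod_cast lt_of_lt_of_le (by norm_num) hD2
    exact Real.log_pos this
  have hR : 0 < bigR D := by
    rw [bigR]
    have : (0 : ℝ) < D := by exact_mod_cast lt_of_lt_of_le (by norm_num) hD2
    exact mul_pos (mul_pos this hP) (pow_pos hℓ _)
  have hs0 : s ≠ 0 := by
    intro h; rw [h] at hre; norm_num at hre
  have hsre : 0 < s.re := by rw [hre]; norm_num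
  -- the pieces
  have ea := vline_one_eq_smoothedSum χ x hD2 hsre hs0 hX
  have eb := hb D χ hDb hq hp x s hrange z hz1 hz2
  obtain ⟨ec1, ec2⟩ := hc D χ hDc hq hp x s hrange z hz1 hz2
  have ee := vline_integrandMain χ x hD2 hX hR (Skeleton.P1 D) s
  have bd := hd D χ hDd hq hp x s hrange z hz1 hz2
  have bf := hf D χ hDf hq hp x s hrange z hz1 hz2
  have bg := hg D χ hDg hq hp x s hrange z hz1 hz2
  have bw := hw D χ hDw hq hp x s hrange (bigP D ^ z) hX
  -- rewrite the target in terms of the objects of this file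
  have hlhs : (∑' n : ℕ, pc χ x n * (n : ℂ) ^ (-s) * (gW D (bigP D ^ z / (n : ℝ)) : ℂ)) =
      smoothedSum χ x (bigP D ^ z) s := rfl
  have hdual : (∑' n : ℕ, conj (pc χ x n) * (n : ℂ) ^ (-(1 - s)) *
      (gW D (bigP D ^ (1 - z) * (D : ℝ) * t0 D / (n : ℝ)) : ℂ)) =
        dualSum χ x (bigR D / bigP D ^ z) s := by
    rw [dualSum, bigR_div_rpow]
  rw [hlhs, hdual]
  -- the exact identity behind the estimate
  set Sm := smoothedSum χ x (bigP D ^ z) s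
  set L0 := (psiChi χ x).LFunction s
  set Z0 := Zpc χ x s
  set dS := dualSum χ x (bigR D / bigP D ^ z) s
  set dH := dualHead χ x (bigR D / bigP D ^ z) (Skeleton.P1 D) s
  set vT := vline (integrandTail χ x (bigP D ^ z) (Skeleton.P1 D) s) (-1)
  set vD := vline (integrandDiff χ x (bigP D ^ z) (Skeleton.P1 D) s) (-1)
  set wD := vseg (integrandDiff χ x (bigP D ^ z) (Skeleton.P1 D) s) 0 (ell D ^ 20)
  have key : Sm - (L0 - Z0 * dS) = Z0 * (dS - dH) + (vD - wD) + wD + vT := by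
    rw [← ea, eb, ec1, ec2, ee]
    ring
  rw [key]
  -- the four error terms
  have hL10 : 0 ≤ ell D ^ 10 := pow_nonneg hℓ.le 10
  have e_d : Real.exp (-cd * ell D ^ 10) ≤ Real.exp (-c * ell D ^ 10) :=
    exp_mono_c (le_trans (min_le_left _ _) le_rfl) hL10
  have e_f : Real.exp (-cf * ell D ^ 10) ≤ Real.exp (-c * ell D ^ 10) :=
    exp_mono_c (le_trans (min_le_right _ _) (min_le_left _ _)) hL10
  have e_g : Real.exp (-cg * ell D ^ 10) ≤ Real.exp (-c * ell D ^ 10) :=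
    exp_mono_c (le_trans (min_le_right _ _) (min_le_right _ _)) hL10
  have hE0 : 0 ≤ E2main χ x s := E2main_nonneg χ x s
  have hε0 : 0 ≤ Real.exp (-c * ell D ^ 10) := Real.exp_nonneg _
  calc ‖Z0 * (dS - dH) + (vD - wD) + wD + vT‖
      ≤ ‖Z0 * (dS - dH)‖ + ‖vD - wD‖ + ‖wD‖ + ‖vT‖ := by
        refine le_trans (norm_add_le _ _) ?_
        gcongr
        refine le_trans (norm_add_le _ _) ?_
        gcongr
        exact norm_add_le _ _
    _ ≤ Cg * Real.exp (-cg * ell D ^ 10) + Cf * Real.exp (-cf * ell D ^ 10) +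
          Cw * E2main χ x s + Cd * Real.exp (-cd * ell D ^ 10) :=
        add_le_add (add_le_add (add_le_add bg bf) bw) bd
    _ ≤ |Cg| * Real.exp (-c * ell D ^ 10) + |Cf| * Real.exp (-c * ell D ^ 10) +
          |Cw| * E2main χ x s + |Cd| * Real.exp (-c * ell D ^ 10) := by
        have t1 : Cg * Real.exp (-cg * ell D ^ 10) ≤ |Cg| * Real.exp (-c * ell D ^ 10) :=
          (mul_le_mul_of_nonneg_right (le_abs_self _) (Real.exp_nonneg _)).trans
            (mul_le_mul_of_nonneg_left e_g (abs_nonneg _))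
        have t2 : Cf * Real.exp (-cf * ell D ^ 10) ≤ |Cf| * Real.exp (-c * ell D ^ 10) :=
          (mul_le_mul_of_nonneg_right (le_abs_self _) (Real.exp_nonneg _)).trans
            (mul_le_mul_of_nonneg_left e_f (abs_nonneg _))
        have t3 : Cw * E2main χ x s ≤ |Cw| * E2main χ x s :=
          mul_le_mul_of_nonneg_right (le_abs_self _) hE0
        have t4 : Cd * Real.exp (-cd * ell D ^ 10) ≤ |Cd| * Real.exp (-c * ell D ^ 10) :=
          (mul_le_mul_of_nonneg_right (le_abs_self _) (Real.exp_nonneg _)).trans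
            (mul_le_mul_of_nonneg_left e_d (abs_nonneg _))
        linarith
    _ ≤ (|Cd| + |Cf| + |Cg| + |Cw|) * (E2main χ x s + Real.exp (-c * ell D ^ 10)) := by
        nlinarith [abs_nonneg Cd, abs_nonneg Cf, abs_nonneg Cg, abs_nonneg Cw]


/-- **`Z22:§11.u024` (repaired) from the two contour estimates (6.2), (6.5) for `χψ` alone**: with
(b) `shiftPole11_holds`, (c) `lineSplit11_holds`, (g) `dualTail11_holds` and the blocks (a), (e),
(B2) PROVED in the tree, the smoothed approximate functional equation `Step11u024e` holds as soon as
`TailSmall11` and `WindowMove11` do. [cite: Zhang2022LandauSiegel, §11 Lemma 11.2 (proof), p. 65] -/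
theorem step11u024e_of_tail_window (hd : TailSmall11) (hf : WindowMove11) : Step11u024e :=
  step11u024e_of shiftPole11_holds lineSplit11_holds hd hf dualTail11_holds

end Assembly

end Literature.NumberTheory.LFunctions.Zhang2022.Section11AFE
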